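import Summits.ResolutionOfSingularities.ResolutionOfSingularities.Theorems.HomologicalConductorNoZenoMinimalityCriterionResidual
import Summits.ResolutionOfSingularities.ResolutionOfSingularities.Theorems.HomologicalConductorNoZenoRLipman131Rational
import Literature.AlgebraicGeometry.Resolution.Lipman1969NegativeDefiniteHolds
import HarnessLib

/-!
# Crux `NoZenoR` (stmt-ResolutionOfSingularities-19943) — the weak minimality criterion `(E²) + h⁰(E) ≤ 0` is
# UNCONDITIONAL on every desingularization of a rational surface singularity; Lipman (27.3) «⇒» from (27.1) ALONE

Route `ResolutionOfSingularities/HomologicalConductor` (cell decomp-res, hand leafhand-res-homologicalconduct-18 g0).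
OURS: AI-written bookkeeping over tree theorems, weaker than expert review; nothing here is a statement of the manuscript
under review (Hironaka 2017).  SUPPORT level, counted 0.  Def-free, no new named facts.

Hand 7's `three_mul_h0_le_h0_sq` / `three_mul_h0_lt_h0_sq_of_isMinimalResolution` /
`isMinimalResolution_iff_criterionM_of_facts'` carry the Lipman prints (13.1) a), (13.1) d), (14.1) as binders.  All three
are now tree theorems — `Lipman1969_13_1_a_holds`, `Lipman12B.Lipman1969_13_1_d_rat_holds` (this hand, via statement B)),
`Lipman1969_14_1_holds` — so:

* `three_mul_h0_le_h0_sq_holds` — **unconditional**: on ANY desingularization `π : X → Spec S` of a two-dimensional normal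
  Noetherian local domain with a rational singularity, every integral exceptional curve satisfies `3·h⁰(𝓘_η) ≤ h⁰(𝓘_η²)`,
  i.e. `(E²) ≤ −h⁰(E)` («`(E²)` is a negative multiple of `h⁰(E)`», Lipman p. 277);
* `three_mul_h0_lt_h0_sq_of_isMinimalResolution_of_27_1`, `lipman_27_3_mp_of_27_1` — the «⇒» half of the named fact
  `Lipman1969_27_3_rat` from `Lipman1969_27_1_reg_rat` ALONE;
* `isMinimalResolution_iff_criterionM_of_27_1_4_1` — the full biconditional of (27.3) from (27.1), (4.1) and the
  first-kind clause (F) of hand 7 (the untyped factorisation clause of (4.1)).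

No crux or summit statement is proved here.
-/

noncomputable section

-- single-problem summit: the doubled namespace component `ResolutionOfSingularities` is forced
set_option linter.dupNamespace false

open CategoryTheory AlgebraicGeometry IsLocalRing
open Literature.AlgebraicGeometry.Resolution Literature.AlgebraicGeometry.Motives

universe u

namespace Summit.ResolutionOfSingularities.ResolutionOfSingularities.Theorems.NoZeno.ExcCount.MinimalNoFirstKind

variable {S : Type u} [CommRing S] [IsNoetherianRing S] [IsLocalRing S] [IsDomain S] [IsIntegrallyClosed S]
  {X : Scheme.{u}} {π : X ⟶ Spec (.of S)}

/-- **`(E²) ≤ −h⁰(E)` on every desingularization of a rational surface singularity — UNCONDITIONAL** (`h⁰`-form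
`3·h⁰(𝓘_η) ≤ h⁰(𝓘_η²)`): hand 7's `three_mul_h0_le_h0_sq` with (13.1) a), (13.1) d), (14.1) supplied by the tree theorems
`Lipman1969_13_1_a_holds`, `Lipman12B.Lipman1969_13_1_d_rat_holds`, `Lipman1969_14_1_holds`.
[cite: Lipman1969, Corollary (27.3), proof (p. 277): "either χ(E) ≤ 0 … or (E²) ≤ −2h⁰(E)"; Lemma (14.1) (p. 224)] -/
theorem three_mul_h0_le_h0_sq_holds (h2 : ringKrullDim S = 2) (hS : HasRationalSingularity S)
    (hπ : IsResolution π) {η : X} (hη : η ∈ excCurvePoints π) :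
    3 * h0 π (primeDivisorIdeal η) ≤ h0 π (primeDivisorIdeal η ^ 2) :=
  three_mul_h0_le_h0_sq Lipman1969_13_1_a_holds Lipman12B.Lipman1969_13_1_d_rat_holds Lipman1969_14_1_holds
    h2 hS hπ hη

/-- **(M) on a MINIMAL desingularization, from (27.1) ALONE**: `3·h⁰(𝓘_η) < h⁰(𝓘_η²)` for every integral exceptional
curve of a minimal desingularization of a rational surface singularity.
[cite: Lipman1969, Corollary (27.3) (p. 277) and Theorem (27.1) (p. 275)] -/
theorem three_mul_h0_lt_h0_sq_of_isMinimalResolution_of_27_1 (h271 : Lipman1969_27_1_reg_rat.{u})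
    (h2 : ringKrullDim S = 2) (hS : HasRationalSingularity S) (hπ : IsMinimalResolution π)
    {η : X} (hη : η ∈ excCurvePoints π) :
    3 * h0 π (primeDivisorIdeal η) < h0 π (primeDivisorIdeal η ^ 2) :=
  three_mul_h0_lt_h0_sq_of_isMinimalResolution' h271 Lipman12B.Lipman1969_13_1_d_rat_holds Lipman1969_14_1_holds
    h2 hS hπ hη

/-- **The «⇒» half of the named fact `Lipman1969_27_3_rat` from `Lipman1969_27_1_reg_rat` ALONE**, in the binder shape
of the fact. [cite: Lipman1969, Corollary (27.3) (p. 277)] -/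
theorem lipman_27_3_mp_of_27_1 (h271 : Lipman1969_27_1_reg_rat.{u})
    (h2 : ringKrullDim S = 2) (hS : HasRationalSingularity S) (X : Scheme.{u}) (π : X ⟶ Spec (.of S))
    (_hπ : IsResolution π) :
    IsMinimalResolution π →
      ∀ η ∈ excCurvePoints π, 3 * h0 π (primeDivisorIdeal η) < h0 π (primeDivisorIdeal η ^ 2) :=
  fun hmin _η hη => three_mul_h0_lt_h0_sq_of_isMinimalResolution_of_27_1 h271 h2 hS hmin hη

/-- **Lipman (27.3), both directions, from (27.1), (4.1) and the first-kind clause (F)** — hand 7's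
`isMinimalResolution_iff_criterionM_of_facts'` with the (13.1) d) and (14.1) binders discharged.
[cite: Lipman1969, Corollary (27.3) (p. 277), Theorem (27.1) (p. 275), Theorem (4.1) (p. 204)] -/
theorem isMinimalResolution_iff_criterionM_of_27_1_4_1 (h271 : Lipman1969_27_1_reg_rat.{u})
    (h41 : Lipman1969_4_1.{u}) (h2 : ringKrullDim S = 2) (hS : HasRationalSingularity S) (hπ : IsResolution π)
    (hF : ∀ (Y : Scheme.{u}) (g : Y ⟶ Spec (.of S)) (h : X ⟶ Y), IsResolution g → h ≫ g = π → ¬ IsIso h →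
      ∃ η ∈ excCurvePoints π, h0 π (primeDivisorIdeal η ^ 2) = 3 * h0 π (primeDivisorIdeal η)) :
    IsMinimalResolution π ↔
      ∀ η ∈ excCurvePoints π, 3 * h0 π (primeDivisorIdeal η) < h0 π (primeDivisorIdeal η ^ 2) :=
  isMinimalResolution_iff_criterionM_of_facts' h271 Lipman12B.Lipman1969_13_1_d_rat_holds Lipman1969_14_1_holds h41
    h2 hS hπ hF

end Summit.ResolutionOfSingularities.ResolutionOfSingularities.Theorems.NoZeno.ExcCount.MinimalNoFirstKind

end
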